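import Literature.MathematicalPhysics.QuantumFieldTheory.Balaban1983to89.B9Eq344CovariantHessianTwoBackgroundRowTower
import Literature.MathematicalPhysics.QuantumFieldTheory.Balaban1983to89.B9Eq3152ThirdWordPiTwoBackgroundLetterTower
import Literature.MathematicalPhysics.QuantumFieldTheory.Balaban1983to89.B9Eq3152ThirdWordGradRowOfHessianRows

/-!
# `Balaban1983to89.B9Eq3152ThirdWordPiTwoBackgroundGradLetterOfOmegaHolder` — T. Bałaban, *Propagators for lattice gauge theories in a background field*, CMP **99** (1985) 389–434
# [Balaban1985BackgroundPropagators] (3.152)–(3.153) p. 426, Thm 3.1 (3.43)–(3.44) p. 398, Thm 3.4 p. 400, Thm 3.13 p. 426; [Balaban1985Variational] (117) p. 295: **`H3 ⇐ Hω` — gen 102's ONE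
# displayed letter `H3` of ROUTE (J′) (the `∇_1` letter of the third word `G̃_kD_UR_kD*_UG̃_k` between two backgrounds, VERBATIM) FOLLOWS FROM A FIRST-ORDER LETTER: the η-scale
# ½-Hölder letter `Hω` of `ω(U) − ω(1)`, `ω = R_kG′_kD*_Uf`, with the small factor `j₀ + α`.**  By (3.152) the word is `D_Uu`, `u = G′_kω` a gauge mode (`Δ^η_Uu = ω` exactly,
# `B9Eq325GreenPrimeOnProjRange`); the `∇_1` letter is the flat covariant gradient of the slice difference `(D_Uu(U))(·,μ) − (D_1u(1))(·,μ)`, bounded by this generation's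
# two-background Hessian slice row `B9Eq344CovariantHessianTwoBackgroundRowTower` fed, in the `cosh` weight centred at `b₋`, by gen 95's (HR) rows and CLOSED Hessian row
# (`B9Eq3152StoreyHClosedOnModel`, `B9Eq344CovariantHessianRowTower`, radius `max(α, j₀)`), gen 102's value letters of `ω(U) − ω(1)` (`B9Eq3152RkGpDstarPiTwoBackgroundLetterTower`) and of
# the third word (`B9Eq3152ThirdWordPiTwoBackgroundLetterTower`), and `Hω`.  NE9 crux-team LEAF PROVER 01, gen 103; cell `pub-balaban`∕`t4`, row NE9, bears_on R4/N22; source READ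
# first-hand (pp. 394–400, 419, 426); composition BY NAME; `rate_letters` adapted from gen 93.
# WHAT IS PROVED (sorry-free; proof lane — 0 `def`): **`exists_gradLetter_thirdWordPi_sub_flat_of_omegaHolder`** — `Hω → H3` (both `∃ α₁ j₁ K κ`-first over the binder block of
# `exists_letter_RkGpDstar_sub_flat`).  HONEST SCOPE: CONDITIONAL on `Hω` (LOCATED: the two-background ½-Hölder ladder of `R_kG′_kD*_U`, first order; NOT in the tree); composition on
# the cell's MODEL rows (O-NE9-1, #5 UNRULED); constants crude; nothing of [B9]∕[B11] asserted as printed; «NE9 ⇐ the named binders»; NE9 NOT PRINTED ∕ NOT PROVED; spine PROVED 0∕9;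
# rung (B)+1 finite T⁴ — NOT infinite volume∕mass gap∕BetaPertH∕Clay.  Continuum YM on T⁴ ⇐ BetaPertH ∧ nine spine estimates (0/9 proved); BetaPertH ⇐ (D1) ∧ (D4) ∧ CAP+tail.

statement-level skeleton of published theorems with citation tags; proofs where landed; nothing here is a claim about the Yang–Mills mass gap
-/


noncomputable section

open scoped InnerProductSpace ComplexConjugate BigOperators

namespace Literature.MathematicalPhysics.QuantumFieldTheory.Balaban1983to89.B9Eq3152ThirdWordPiTwoBackgroundGradLetterOfOmegaHolder

open B4Sect5Torus (TSite tdist tdist_nonneg tdist_triangle tdist_symm)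
open B4TorusKernel.MultiPeriod (circAbs)
open B9SectCLatticeCarrier (Bond bpos btgt shift unshift)
open B9Eq311L2Pairing (WL2)
open B9Eq319QprimeTorus (blockCoord)
open B7Prop1Explicit (U1 Wcx boxVec)
open B11Eq103H1Complex (SiteL2K BondL2K covDerivL2K covDivL2K covLaplaceSiteK G1LatticeK equiv_covDerivL2K)
open B9Eq33CovDerivVector (covGrad covGrad_eq_covDeriv_comp shiftEquiv)
open B9Eq310DeltaPrime (plaqHolU)
open B9Eq310HessianOperator (adTransportW)
open B9Eq310HessianHermitian (adTransportW_adjoint)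
open B9Eq315QTorus (perCfg cornerSite)
open B9Eq315QTower (towerP towerP_apply UlevOf)
open B9Eq315QTowerFlat (perCfg_UlevOf_one_mem_U1 norm_Wcx_UlevOf_one_sub_one_le)
open B9Eq316TowerFlatIsOneStep (towerP_eq_fineP_pow siteCast)
open B9Eq326OperatorTower (QkW laplaceAk G1k RofUk QkW_surjective)
open B9Eq324DeltaPrimeATower (laplacePrimeAk GpOfUk)
open B9Eq3119DeltaPiTower (laplaceAkPi)
open B9Eq3119DeltaPiTowerFlat (laplaceAkPi_one_pos_iff letters_laplaceAkPi_one)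
open B9Eq342CoshWeightSite (weight_site_centre weight_site_pos)
open B9Eq342GreenPrimeSupBoundDecayCosh (rate_explicit)
open B9Eq342GreenPrimeTowerSupBoundDecayCosh (exp_bigBlockDist_le_weight_site)
open B9Eq342CovariantResolventAdjointRowLetters (rePos_covLaplaceSiteK_add)
open B9Eq325GreenPrimeOnProjRange (covLaplaceSiteK_GpOfUk_RofUk)
open B9Eq3152GtildeThirdWordTwoSided (thirdWord_G1LatticeKPi_eq)
open B9Eq3152ThirdWordGradRowOfHessianRows (norm_plaqU_sub_one_le_of_plaqHolU)
open B9Eq344CovariantHessianRowTower (exists_hessRow_of_laplace_eq)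
open B9Eq344CovariantHessianTwoBackgroundRowTower (exists_flatGradRow_hessSlice_sub_flat)
open B9Eq3152StoreyHClosedOnModel (rows_RkGpDstar_GpOfUk_hold)
open B9Eq3152RkGpDstarPiTwoBackgroundLetterTower (exists_letter_RkGpDstar_sub_flat)
open B9Eq3152ThirdWordPiTwoBackgroundLetterTower (exists_letter_thirdWordPi_sub_flat)
open B9Eq33CovDerivLocalLetterTower (tdist_bigBlock_bpos_btgt_le_one)

/-- the rate `a = min(a⋆, κ∕(dK))`: window, `aK ≤ 1`, `adK ≤ κ`, and the uniform lower bound `aK ≥ min(√(1∕(4d+1)), κ∕d)`.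
-- adapted from gen 93's private `B9Eq343ResolventHolderRowTowerOfFlat.rate_letters` (copied by gen 95's junction) [folklore] -/
private theorem rate_letters {d t as κ : ℝ} (hd1 : 1 ≤ d) (ht : 0 < t) (has0 : 0 < as) (has1 : as ≤ 1) (hκ : 0 < κ)
    (hlams : 1 / 2 ≤ 1 - 2 * d * t ^ 2 * (Real.cosh as - 1)) (hasq : as ^ 2 = 1 / (4 * d * t ^ 2 + 1)) (haKs : Real.sqrt (1 / (4 * d + 1)) ≤ as * t) :
    ∃ a : ℝ, 0 ≤ a ∧ a ≤ 1 ∧ a * t ≤ 1 ∧ 1 / 2 ≤ 1 - 2 * d * t ^ 2 * (Real.cosh a - 1) ∧ a * d * t ≤ κ ∧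
      min (Real.sqrt (1 / (4 * d + 1))) (κ / d) ≤ a * t := by
  have hd0 : 0 < d := by linarith
  have ha0 : 0 ≤ min as (κ / (d * t)) := le_min has0.le (by positivity)
  have haas : min as (κ / (d * t)) ≤ as := min_le_left _ _
  have hats : as * t ≤ 1 := by
    have h2 : (as * t) ^ 2 ≤ 1 := by
      rw [mul_pow, hasq, div_mul_eq_mul_div, one_mul, div_le_one (by positivity)]
      nlinarith [sq_nonneg t, mul_le_mul_of_nonneg_right hd1 (sq_nonneg t)]
    nlinarith [mul_nonneg has0.le ht.le]
  have hcosh : Real.cosh (min as (κ / (d * t))) ≤ Real.cosh as := by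
    rw [Real.cosh_le_cosh, abs_of_nonneg ha0, abs_of_nonneg has0.le]; exact haas
  refine ⟨min as (κ / (d * t)), ha0, haas.trans has1, (mul_le_mul_of_nonneg_right haas ht.le).trans hats, ?_, ?_, ?_⟩
  · nlinarith [mul_nonneg (mul_nonneg (by norm_num : (0:ℝ) ≤ 2) hd0.le) (sq_nonneg t)]
  · calc min as (κ / (d * t)) * d * t ≤ (κ / (d * t)) * d * t := by gcongr; exact min_le_right _ _
      _ = κ := by field_simp
  · rw [min_mul_of_nonneg _ _ ht.le]
    exact min_le_min haKs (le_of_eq (by field_simp))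

variable {d : ℕ} (hd : 1 ≤ d) (L : ℕ) [NeZero L] (hL : 1 ≤ L) (hL3 : 3 ≤ L)
  {𝔸 : Type*} [NormedRing 𝔸] [NormedAlgebra ℂ 𝔸] [CompleteSpace 𝔸] [NormOneClass 𝔸] [StarRing 𝔸] [NormedStarGroup 𝔸] [StarModule ℂ 𝔸] [FiniteDimensional ℂ 𝔸]
  {W : Type*} [NormedAddCommGroup W] [InnerProductSpace ℂ W] [FiniteDimensional ℂ W] (φ : W ≃ₗ[ℂ] 𝔸)
  {Mφ Mφ' : ℝ} (hMφ : 0 ≤ Mφ) (hMφ' : 0 ≤ Mφ') (hφ : ∀ w, ‖φ w‖ ≤ Mφ * ‖w‖) (hφ' : ∀ X, ‖φ.symm X‖ ≤ Mφ' * ‖X‖) (hstar : ∀ X : 𝔸, ‖star X‖ ≤ ‖X‖)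
  {a : ℝ} (ha : 0 < a) {a' : ℝ} (ha' : 0 < a') {ϱ : ℝ} (hϱ0 : 0 ≤ ϱ) (hϱ1 : ϱ < 1)
  (τ : 𝔸 →ₗ[ℂ] ℂ) {Cτ : ℝ} (hτ : ∀ X, ‖τ X‖ ≤ Cτ * ‖X‖) (hCτ : 0 ≤ Cτ) {Mτ : ℝ} (hτm : ∀ X Y : 𝔸, ‖τ (X * Y)‖ ≤ Mτ * ‖X‖ * ‖Y‖) (hMτ : 0 ≤ Mτ)
  {ρw : ℝ} (hρw : 0 ≤ ρw)
  (hτ₁ : ∀ X : 𝔸, τ (star X) = conj (τ X)) (hτ₂ : ∀ X Y : 𝔸, τ (X * Y) = τ (Y * X)) (hφτ : ∀ X Y : 𝔸, ⟪φ.symm X, φ.symm Y⟫_ℂ = τ (star X * Y))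
  (AQ : ℝ)
  {ι : Type} [Fintype ι] [DecidableEq ι] (b : Module.Basis ι ℝ 𝔸) {M₂ : ℝ} (hM₂ : 0 ≤ M₂) (hrepr : ∀ (v : 𝔸) (i : ι), |b.repr v i| ≤ M₂ * ‖v‖)

include hd hL hL3 hMφ hMφ' hφ hφ' hstar ha ha' hϱ0 hϱ1 hτ hCτ hτm hMτ hρw hτ₁ hτ₂ hφτ hM₂ hrepr in
set_option maxHeartbeats 6400000 in
set_option maxRecDepth 8192 in
/-- **`H3 ⇐ Hω`**: gen 102's displayed `∇_1` letter `H3` of the third word between two backgrounds, VERBATIM, from the η-Hölder letter `Hω` of `ω(U) − ω(1)`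
(`ω = R_kG′_kD*_Uf`) — see the module docstring. [folklore] [cite: Balaban1985BackgroundPropagators, (3.152)–(3.153) p.426, Thm 3.1 (3.43)–(3.44) p.398, Thm 3.4 p.400,
(3.60)–(3.65) pp.402–403, (3.117)–(3.120) p.419, Thm 3.13 p.426, (3.35)–(3.36) p.396; Balaban1985Variational, (117) p.295] -/
theorem exists_gradLetter_thirdWordPi_sub_flat_of_omegaHolder
    (Hω : ∃ α₁ j₁ K κ : ℝ, 0 < α₁ ∧ 0 < j₁ ∧ 0 ≤ K ∧ 0 < κ ∧
      ∀ (n : ℕ) (η : ℝ) (_hηL : η * (L : ℝ) ^ (n + 1) = 1) (c₀ c₁ : ℝ) [Fact (0 < c₀)] [Fact (0 < c₁)]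
        (_hw : c₀ * ((L : ℝ) ^ (n + 1)) ^ d = c₁) (_hρ : |η| ^ d / c₀ ≤ ρw) (m : Fin d → ℕ) [∀ i, NeZero (m i)] (_hm : ∀ i, 1 ≤ m i)
        (U : Bond d (towerP L m (n + 1)) → 𝔸ˣ) (αU : ℕ → ℝ) (_hα0 : ∀ j, 0 ≤ αU j) (hα1 : ∀ j, αU j ≤ 1 / 64)
        (_hαL : ∀ j, 50 * (d + 1) * αU j * (L : ℝ) ^ d ≤ 1 / 2)
        (hU1 : ∀ (j : ℕ) (x : B7Prop1Explicit.Site d) (k : Fin d), perCfg (towerP L m (j + 1)) (UlevOf L m (n + 1) U j) x k ∈ U1 𝔸)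
        (hreg : ∀ (j : ℕ) (y : TSite d (towerP L m j)) (k : Fin d) (ρ' : Fin d → Fin L),
          ‖((Wcx L (perCfg (towerP L m (j + 1)) (UlevOf L m (n + 1) U j)) (cornerSite L y) k (boxVec L ρ') : 𝔸ˣ) : 𝔸) - 1‖ ≤ αU j)
        (εU : ℕ → ℝ) (_hεU : ∀ j, 0 ≤ εU j) (_hε1 : ∀ j, εU j ≤ 1) (_hUε : ∀ (j : ℕ) (b : Bond d (towerP L m (j + 1))), ‖(UlevOf L m (n + 1) U j b : 𝔸) - 1‖ ≤ εU j)
        (_hLb : ∀ (j : ℕ) (b : Bond d (towerP L m (j + 1))), UlevOf L m (n + 1) U j b ∈ U1 𝔸)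
        (α : ℝ) (_hα : 0 ≤ α) (_hαle : α ≤ α₁)
        (hUst : ∀ b, star (U b : 𝔸) = (((U b)⁻¹ : 𝔸ˣ) : 𝔸)) (_hUb : ∀ b, U b ∈ U1 𝔸) (_hUη : ∀ b, ‖(U b : 𝔸) - 1‖ ≤ α * η)
        (_hUw : ∀ (x : TSite d (towerP L m (n + 1))) (μ ν : Fin d), ‖(U (shift ν x, μ) : 𝔸) - (U (x, μ) : 𝔸)‖ ≤ α * η ^ 2)
        (_hpl : ∀ p : B9SectCLatticeCarrier.Plaq d (towerP L m (n + 1)), ‖(plaqHolU U p : 𝔸) - 1‖ ≤ α * η ^ 2)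
        (_hUgrad : ∀ (x : TSite d (towerP L m (n + 1))) (μ : Fin d), ‖(U (x, μ) : 𝔸) - U (unshift μ x, μ)‖ ≤ α * η ^ 2)
        (_hRlev : ∀ (j : ℕ) (b : Bond d (towerP L m (j + 1))) (w : W), ‖adTransportW φ (UlevOf L m (n + 1) U j) b w‖ ≤ ‖w‖)
        (_hεg : ∀ j < n + 1, εU j ≤ α * ϱ ^ j) (_hAQ : ∑ j ∈ Finset.range (n + 1), αU j ≤ AQ)
        (hpos' : ∀ x : SiteL2K ℂ d (towerP L m (n + 1)) c₀ W, x ≠ 0 → 0 < RCLike.re ⟪x, laplacePrimeAk L m n φ η U a' (c₁ := c₁) x⟫_ℂ)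
        (hpos : ∀ x : BondL2K ℂ d (towerP L m (n + 1)) c₀ W, x ≠ 0 →
          0 < RCLike.re ⟪x, laplaceAk L m n φ η U hL αU hα1 hU1 hreg τ (c₀ := c₀) (c₁ := c₁) a x⟫_ℂ)
        (_hc₀η : c₀ = η ^ d) (j₀ : ℝ) (_hJ : ∀ μ y, ‖B9Eq39Adjoint.J (fun μ => B9Eq33CovDerivVector.shiftEquiv μ) (fun μ y => U (y, μ)) η μ y‖ ≤ j₀) (_hj : j₀ ≤ j₁)
        (hposπ : ∀ x : BondL2K ℂ d (towerP L m (n + 1)) c₀ W, x ≠ 0 →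
          0 < RCLike.re ⟪x, laplaceAkPi L m n φ τ η U a' hpos' hL αU hα1 hU1 hreg (c₁ := c₁) a x⟫_ℂ)
        (_hQ : Function.Surjective (QkW L m n φ U hL αU hα1 hU1 hreg (c₀ := c₀) (c₁ := c₁)))
        (hpos'₁ : ∀ x : SiteL2K ℂ d (towerP L m (n + 1)) c₀ W, x ≠ 0 →
          0 < RCLike.re ⟪x, laplacePrimeAk L m n φ η (fun _ : Bond d (towerP L m (n + 1)) => (1 : 𝔸ˣ)) a' (c₁ := c₁) x⟫_ℂ)
        (hpos₁ : ∀ x : BondL2K ℂ d (towerP L m (n + 1)) c₀ W, x ≠ 0 →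
          0 < RCLike.re ⟪x, laplaceAk L m n φ η (fun _ : Bond d (towerP L m (n + 1)) => (1 : 𝔸ˣ)) hL (fun _ => 0) (fun _ => by norm_num)
            (perCfg_UlevOf_one_mem_U1 L m (n + 1)) (norm_Wcx_UlevOf_one_sub_one_le L m (n + 1) (fun _ => 0) (fun _ => le_rfl)) τ
            (c₀ := c₀) (c₁ := c₁) a x⟫_ℂ)
        (v : TSite d m) (f : BondL2K ℂ d (towerP L m (n + 1)) c₀ W) (F : ℝ)
        (_hfv : ∀ b', blockCoord (L ^ (n + 1)) m (siteCast (towerP_eq_fineP_pow L m (n + 1)) (bpos b')) ≠ v → WL2.equiv ℂ (fun _ : Bond d (towerP L m (n + 1)) => c₀) W f b' = 0)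
        (_hfF : ∀ b', ‖WL2.equiv ℂ (fun _ : Bond d (towerP L m (n + 1)) => c₀) W f b'‖ ≤ F) (y y' : TSite d (towerP L m (n + 1)))
        (_hyy : tdist (towerP L m (n + 1)) y y' ≤ (L : ℝ) ^ (n + 1)),
        ‖WL2.equiv ℂ (fun _ : TSite d (towerP L m (n + 1)) => c₀) W
            (RofUk L m n φ η U (c₀ := c₀) (GpOfUk L m n φ η U a' (c₁ := c₁) hpos' (covDivL2K ℂ c₀ ((η : ℂ))⁻¹ (adTransportW φ fun bb => (U bb)⁻¹) f)) -
              RofUk L m n φ η (fun _ : Bond d (towerP L m (n + 1)) => (1 : 𝔸ˣ)) (c₀ := c₀)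
                (GpOfUk L m n φ η (fun _ : Bond d (towerP L m (n + 1)) => (1 : 𝔸ˣ)) a' (c₁ := c₁) hpos'₁
                  (covDivL2K ℂ c₀ ((η : ℂ))⁻¹ (adTransportW φ fun bb => ((fun _ : Bond d (towerP L m (n + 1)) => (1 : 𝔸ˣ)) bb)⁻¹) f))) y' -
          WL2.equiv ℂ (fun _ : TSite d (towerP L m (n + 1)) => c₀) W
            (RofUk L m n φ η U (c₀ := c₀) (GpOfUk L m n φ η U a' (c₁ := c₁) hpos' (covDivL2K ℂ c₀ ((η : ℂ))⁻¹ (adTransportW φ fun bb => (U bb)⁻¹) f)) -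
              RofUk L m n φ η (fun _ : Bond d (towerP L m (n + 1)) => (1 : 𝔸ˣ)) (c₀ := c₀)
                (GpOfUk L m n φ η (fun _ : Bond d (towerP L m (n + 1)) => (1 : 𝔸ˣ)) a' (c₁ := c₁) hpos'₁
                  (covDivL2K ℂ c₀ ((η : ℂ))⁻¹ (adTransportW φ fun bb => ((fun _ : Bond d (towerP L m (n + 1)) => (1 : 𝔸ˣ)) bb)⁻¹) f))) y‖ ≤
          (j₀ + α) * K * Real.exp (-(κ * tdist m (blockCoord (L ^ (n + 1)) m (siteCast (towerP_eq_fineP_pow L m (n + 1)) y)) v)) *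
            (tdist (towerP L m (n + 1)) y y' / (L : ℝ) ^ (n + 1)) ^ ((1 : ℝ) / 2) * F) :
    ∃ α₁ j₁ K κ : ℝ, 0 < α₁ ∧ 0 < j₁ ∧ 0 ≤ K ∧ 0 < κ ∧
      ∀ (n : ℕ) (η : ℝ) (_hηL : η * (L : ℝ) ^ (n + 1) = 1) (c₀ c₁ : ℝ) [Fact (0 < c₀)] [Fact (0 < c₁)]
        (_hw : c₀ * ((L : ℝ) ^ (n + 1)) ^ d = c₁) (_hρ : |η| ^ d / c₀ ≤ ρw) (m : Fin d → ℕ) [∀ i, NeZero (m i)] (_hm : ∀ i, 1 ≤ m i)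
        (U : Bond d (towerP L m (n + 1)) → 𝔸ˣ) (αU : ℕ → ℝ) (_hα0 : ∀ j, 0 ≤ αU j) (hα1 : ∀ j, αU j ≤ 1 / 64)
        (_hαL : ∀ j, 50 * (d + 1) * αU j * (L : ℝ) ^ d ≤ 1 / 2)
        (hU1 : ∀ (j : ℕ) (x : B7Prop1Explicit.Site d) (k : Fin d), perCfg (towerP L m (j + 1)) (UlevOf L m (n + 1) U j) x k ∈ U1 𝔸)
        (hreg : ∀ (j : ℕ) (y : TSite d (towerP L m j)) (k : Fin d) (ρ' : Fin d → Fin L),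
          ‖((Wcx L (perCfg (towerP L m (j + 1)) (UlevOf L m (n + 1) U j)) (cornerSite L y) k (boxVec L ρ') : 𝔸ˣ) : 𝔸) - 1‖ ≤ αU j)
        (εU : ℕ → ℝ) (_hεU : ∀ j, 0 ≤ εU j) (_hε1 : ∀ j, εU j ≤ 1) (_hUε : ∀ (j : ℕ) (b : Bond d (towerP L m (j + 1))), ‖(UlevOf L m (n + 1) U j b : 𝔸) - 1‖ ≤ εU j)
        (_hLb : ∀ (j : ℕ) (b : Bond d (towerP L m (j + 1))), UlevOf L m (n + 1) U j b ∈ U1 𝔸)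
        (α : ℝ) (_hα : 0 ≤ α) (_hαle : α ≤ α₁)
        (hUst : ∀ b, star (U b : 𝔸) = (((U b)⁻¹ : 𝔸ˣ) : 𝔸)) (_hUb : ∀ b, U b ∈ U1 𝔸) (_hUη : ∀ b, ‖(U b : 𝔸) - 1‖ ≤ α * η)
        (_hUw : ∀ (x : TSite d (towerP L m (n + 1))) (μ ν : Fin d), ‖(U (shift ν x, μ) : 𝔸) - (U (x, μ) : 𝔸)‖ ≤ α * η ^ 2)
        (_hpl : ∀ p : B9SectCLatticeCarrier.Plaq d (towerP L m (n + 1)), ‖(plaqHolU U p : 𝔸) - 1‖ ≤ α * η ^ 2)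
        (_hUgrad : ∀ (x : TSite d (towerP L m (n + 1))) (μ : Fin d), ‖(U (x, μ) : 𝔸) - U (unshift μ x, μ)‖ ≤ α * η ^ 2)
        (_hRlev : ∀ (j : ℕ) (b : Bond d (towerP L m (j + 1))) (w : W), ‖adTransportW φ (UlevOf L m (n + 1) U j) b w‖ ≤ ‖w‖)
        (_hεg : ∀ j < n + 1, εU j ≤ α * ϱ ^ j) (_hAQ : ∑ j ∈ Finset.range (n + 1), αU j ≤ AQ)
        (hpos' : ∀ x : SiteL2K ℂ d (towerP L m (n + 1)) c₀ W, x ≠ 0 → 0 < RCLike.re ⟪x, laplacePrimeAk L m n φ η U a' (c₁ := c₁) x⟫_ℂ)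
        (hpos : ∀ x : BondL2K ℂ d (towerP L m (n + 1)) c₀ W, x ≠ 0 →
          0 < RCLike.re ⟪x, laplaceAk L m n φ η U hL αU hα1 hU1 hreg τ (c₀ := c₀) (c₁ := c₁) a x⟫_ℂ)
        (_hc₀η : c₀ = η ^ d) (j₀ : ℝ) (_hJ : ∀ μ y, ‖B9Eq39Adjoint.J (fun μ => B9Eq33CovDerivVector.shiftEquiv μ) (fun μ y => U (y, μ)) η μ y‖ ≤ j₀) (_hj : j₀ ≤ j₁)
        (hposπ : ∀ x : BondL2K ℂ d (towerP L m (n + 1)) c₀ W, x ≠ 0 →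
          0 < RCLike.re ⟪x, laplaceAkPi L m n φ τ η U a' hpos' hL αU hα1 hU1 hreg (c₁ := c₁) a x⟫_ℂ)
        (_hQ : Function.Surjective (QkW L m n φ U hL αU hα1 hU1 hreg (c₀ := c₀) (c₁ := c₁)))
        (hpos'₁ : ∀ x : SiteL2K ℂ d (towerP L m (n + 1)) c₀ W, x ≠ 0 →
          0 < RCLike.re ⟪x, laplacePrimeAk L m n φ η (fun _ : Bond d (towerP L m (n + 1)) => (1 : 𝔸ˣ)) a' (c₁ := c₁) x⟫_ℂ)
        (hpos₁ : ∀ x : BondL2K ℂ d (towerP L m (n + 1)) c₀ W, x ≠ 0 →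
          0 < RCLike.re ⟪x, laplaceAk L m n φ η (fun _ : Bond d (towerP L m (n + 1)) => (1 : 𝔸ˣ)) hL (fun _ => 0) (fun _ => by norm_num)
            (perCfg_UlevOf_one_mem_U1 L m (n + 1)) (norm_Wcx_UlevOf_one_sub_one_le L m (n + 1) (fun _ => 0) (fun _ => le_rfl)) τ
            (c₀ := c₀) (c₁ := c₁) a x⟫_ℂ)
        (v : TSite d m) (f : BondL2K ℂ d (towerP L m (n + 1)) c₀ W) (F : ℝ)
        (_hfv : ∀ b', blockCoord (L ^ (n + 1)) m (siteCast (towerP_eq_fineP_pow L m (n + 1)) (bpos b')) ≠ v → WL2.equiv ℂ (fun _ : Bond d (towerP L m (n + 1)) => c₀) W f b' = 0)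
        (_hfF : ∀ b', ‖WL2.equiv ℂ (fun _ : Bond d (towerP L m (n + 1)) => c₀) W f b'‖ ≤ F) (μ : Fin d) (bd : Bond d (towerP L m (n + 1))),
        ‖covGrad ((η : ℂ))⁻¹ (adTransportW φ (fun _ : Bond d (towerP L m (n + 1)) => (1 : 𝔸ˣ))) (WL2.equiv ℂ (fun _ : Bond d (towerP L m (n + 1)) => c₀) W
            (G1LatticeK hposπ (covDerivL2K ℂ c₀ ((η : ℂ))⁻¹ (adTransportW φ U) (RofUk L m n φ η U (c₀ := c₀)
                (covDivL2K ℂ c₀ ((η : ℂ))⁻¹ (adTransportW φ fun bb => (U bb)⁻¹) (G1LatticeK hposπ f)))) -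
              G1k L m n φ η (fun _ : Bond d (towerP L m (n + 1)) => (1 : 𝔸ˣ)) hL (fun _ => 0) (fun _ => by norm_num)
                (perCfg_UlevOf_one_mem_U1 L m (n + 1)) (norm_Wcx_UlevOf_one_sub_one_le L m (n + 1) (fun _ => 0) (fun _ => le_rfl)) τ (c₀ := c₀) (c₁ := c₁) hpos₁
                (covDerivL2K ℂ c₀ ((η : ℂ))⁻¹ (adTransportW φ (fun _ : Bond d (towerP L m (n + 1)) => (1 : 𝔸ˣ)))
                  (RofUk L m n φ η (fun _ : Bond d (towerP L m (n + 1)) => (1 : 𝔸ˣ)) (c₀ := c₀)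
                    (covDivL2K ℂ c₀ ((η : ℂ))⁻¹ (adTransportW φ fun bb => ((fun _ : Bond d (towerP L m (n + 1)) => (1 : 𝔸ˣ)) bb)⁻¹)
                      (G1k L m n φ η (fun _ : Bond d (towerP L m (n + 1)) => (1 : 𝔸ˣ)) hL (fun _ => 0) (fun _ => by norm_num)
                        (perCfg_UlevOf_one_mem_U1 L m (n + 1)) (norm_Wcx_UlevOf_one_sub_one_le L m (n + 1) (fun _ => 0) (fun _ => le_rfl)) τ (c₀ := c₀) (c₁ := c₁)
                        hpos₁ f)))))) (bd, μ)‖ ≤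
          (j₀ + α) * K * Real.exp (-(κ * tdist m (blockCoord (L ^ (n + 1)) m (siteCast (towerP_eq_fineP_pow L m (n + 1)) (btgt bd))) v)) * F := by
  classical
  obtain ⟨αa, Ba, δa, hαa, hBa, hδa, HA⟩ :=
    rows_RkGpDstar_GpOfUk_hold hd L hL hL3 φ hMφ hMφ' hφ hφ' ha ha' hϱ0 hϱ1 τ hτ hCτ hMτ hρw hτ₁ hτ₂ hφτ AQ
  obtain ⟨αH, ΘH, κH, hαH, hΘH, hκH, HH⟩ := exists_hessRow_of_laplace_eq L hL3 φ (a' := a') hMφ hMφ' hφ hφ' ha' hϱ0 hϱ1 τ hτ₂ hφτ hd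
  obtain ⟨αB, ΘB, κB, hαB, hΘB, hκB, HB⟩ := exists_flatGradRow_hessSlice_sub_flat L hL3 φ (a' := a') hMφ hMφ' hφ hφ' ha' hϱ0 hϱ1 τ hτ₂ hφτ hd
  obtain ⟨αO, jO, KO, κO, hαO, hjO, hKO, hκO, HO⟩ :=
    exists_letter_RkGpDstar_sub_flat hd L hL hL3 φ hMφ hMφ' hφ hφ' hstar ha ha' hϱ0 hϱ1 τ hτ hCτ hτm hMτ hρw hτ₁ hτ₂ hφτ AQ b hM₂ hrepr
  obtain ⟨αT, jT, KT, κT, hαT, hjT, hKT, hκT, HT⟩ :=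
    exists_letter_thirdWordPi_sub_flat hd L hL hL3 φ hMφ hMφ' hφ hφ' hstar ha ha' hϱ0 hϱ1 τ hτ hCτ hτm hMτ hρw hτ₁ hτ₂ hφτ AQ b hM₂ hrepr
  obtain ⟨αω, jω, Kω, κω, hαω, hjω, hKω, hκω, HΩ⟩ := Hω
  obtain ⟨hd1, hd0⟩ : (1 : ℝ) ≤ d ∧ (0 : ℝ) < d := ⟨by exact_mod_cast hd, by exact_mod_cast hd⟩
  set κs : ℝ := min κH κB with hκs
  have hκs0 : 0 < κs := lt_min hκH hκB
  set δ₃ : ℝ := min (min (min δa κO) (min κT κω)) (min (Real.sqrt (1 / (4 * d + 1))) (κs / d)) with hδ₃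
  have hδ₃0 : 0 < δ₃ := lt_min (lt_min (lt_min hδa hκO) (lt_min hκT hκω)) (lt_min (Real.sqrt_pos.2 (by positivity)) (by positivity))
  obtain ⟨hδ₃a, hδ₃O, hδ₃T, hδ₃ω⟩ : δ₃ ≤ δa ∧ δ₃ ≤ κO ∧ δ₃ ≤ κT ∧ δ₃ ≤ κω :=
    ⟨(min_le_left _ _).trans ((min_le_left _ _).trans (min_le_left _ _)), (min_le_left _ _).trans ((min_le_left _ _).trans (min_le_right _ _)),
      (min_le_left _ _).trans ((min_le_right _ _).trans (min_le_left _ _)), (min_le_left _ _).trans ((min_le_right _ _).trans (min_le_right _ _))⟩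
  set Kfin : ℝ := ΘB * 6 * (4 * Ba * (1 + ΘH) + (KO + Kω + KT)) * Real.exp δ₃ with hKfin
  refine ⟨min (min αa αH) (min (min αB αO) (min αT αω)), min (min αa αH) (min jO (min jT jω)), Kfin, δ₃,
    lt_min (lt_min hαa hαH) (lt_min (lt_min hαB hαO) (lt_min hαT hαω)), lt_min (lt_min hαa hαH) (lt_min hjO (lt_min hjT hjω)), by positivity, hδ₃0, ?_⟩
  intro n η hηL c₀ c₁ _ _ hw hρ m _ hm U αU hα0 hα1 hαL hU1 hreg εU hεU hε1 hUε hLb α hα hαle hUst hUb hUη hUw hpl hUgrad hRlev hεg hAQ hpos' hpos hc₀η j₀ hJ hj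
    hposπ hQ hpos'₁ hpos₁ v f F hfv hfF μ bd
  obtain ⟨hαa', hαH', hαB', hαO', hαT', hαω'⟩ : α ≤ αa ∧ α ≤ αH ∧ α ≤ αB ∧ α ≤ αO ∧ α ≤ αT ∧ α ≤ αω :=
    ⟨hαle.trans ((min_le_left _ _).trans (min_le_left _ _)), hαle.trans ((min_le_left _ _).trans (min_le_right _ _)),
      hαle.trans ((min_le_right _ _).trans ((min_le_left _ _).trans (min_le_left _ _))), hαle.trans ((min_le_right _ _).trans ((min_le_left _ _).trans (min_le_right _ _))),
      hαle.trans ((min_le_right _ _).trans ((min_le_right _ _).trans (min_le_left _ _))), hαle.trans ((min_le_right _ _).trans ((min_le_right _ _).trans (min_le_right _ _)))⟩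
  obtain ⟨hja', hjH', hjO', hjT', hjω'⟩ : j₀ ≤ αa ∧ j₀ ≤ αH ∧ j₀ ≤ jO ∧ j₀ ≤ jT ∧ j₀ ≤ jω :=
    ⟨hj.trans ((min_le_left _ _).trans (min_le_left _ _)), hj.trans ((min_le_left _ _).trans (min_le_right _ _)), hj.trans ((min_le_right _ _).trans (min_le_left _ _)),
      hj.trans ((min_le_right _ _).trans ((min_le_right _ _).trans (min_le_left _ _))), hj.trans ((min_le_right _ _).trans ((min_le_right _ _).trans (min_le_right _ _)))⟩
  obtain ⟨hF, hj₀⟩ : 0 ≤ F ∧ 0 ≤ j₀ := ⟨(norm_nonneg _).trans (hfF bd), (norm_nonneg _).trans (hJ ⟨0, hd⟩ fun _ => 0)⟩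
  have hK1 : (1 : ℝ) ≤ (L : ℝ) ^ (n + 1) := one_le_pow₀ (by exact_mod_cast hL)
  have hK0 : (0 : ℝ) < (L : ℝ) ^ (n + 1) := lt_of_lt_of_le one_pos hK1
  obtain ⟨hη0, hηK⟩ : 0 < η ∧ η⁻¹ = (L : ℝ) ^ (n + 1) := ⟨by nlinarith only [hηL, hK0], inv_eq_of_mul_eq_one_right hηL⟩
  set α' : ℝ := max α j₀ with hα'
  obtain ⟨hα'0, hαα', hα'a, hα'H⟩ : 0 ≤ α' ∧ α ≤ α' ∧ α' ≤ αa ∧ α' ≤ αH := ⟨hα.trans (le_max_left _ _), le_max_left _ _, max_le hαa' hja', max_le hαH' hjH'⟩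
  have hUη' : ∀ b', ‖(U b' : 𝔸) - 1‖ ≤ α' * η := fun b' => (hUη b').trans (by gcongr)
  have hpl' : ∀ p : B9SectCLatticeCarrier.Plaq d (towerP L m (n + 1)), ‖(plaqHolU U p : 𝔸) - 1‖ ≤ α' * η ^ 2 := fun p => (hpl p).trans (by gcongr)
  have hUgrad' : ∀ (x : TSite d (towerP L m (n + 1))) (μ' : Fin d), ‖(U (x, μ') : 𝔸) - U (unshift μ' x, μ')‖ ≤ α' * η ^ 2 := fun x μ' => (hUgrad x μ').trans (by gcongr)
  have hεg' : ∀ j < n + 1, εU j ≤ α' * ϱ ^ j := fun j hj' => (hεg j hj').trans (mul_le_mul_of_nonneg_right hαα' (pow_nonneg hϱ0 j))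
  have hJ' : ∀ (μ' : Fin d) (y' : TSite d (towerP L m (n + 1))),
      ‖B9Eq39Adjoint.J (fun μ => B9Eq33CovDerivVector.shiftEquiv μ) (fun μ y => U (y, μ)) η μ' y'‖ ≤ α' := fun μ' y' => (hJ μ' y').trans (le_max_right _ _)
  have hplU := norm_plaqU_sub_one_le_of_plaqHolU U hUb (by positivity : 0 ≤ α * η ^ 2) hpl
  have hplU' := norm_plaqU_sub_one_le_of_plaqHolU U hUb (by positivity : 0 ≤ α' * η ^ 2) hpl'
  have hpos₁U : ∀ z : SiteL2K ℂ d (towerP L m (n + 1)) c₀ W, z ≠ 0 →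
      0 < RCLike.re ⟪z, ((covLaplaceSiteK (c₀ := c₀) ((η : ℂ))⁻¹ (adTransportW φ U) (adTransportW φ fun bb => (U bb)⁻¹) + (1 : ℂ) • LinearMap.id :
        SiteL2K ℂ d (towerP L m (n + 1)) c₀ W →ₗ[ℂ] SiteL2K ℂ d (towerP L m (n + 1)) c₀ W)) z⟫_ℂ := by
    have h := rePos_covLaplaceSiteK_add (c₀ := c₀) η⁻¹ one_pos (adTransportW φ U) (adTransportW φ fun bb => (U bb)⁻¹) (adTransportW_adjoint φ τ hτ₂ hUst hφτ)
    simp only [Complex.ofReal_inv, Complex.ofReal_one] at h; exact h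
  have hαL1 : ∀ j : ℕ, 50 * (d + 1) * (fun _ : ℕ => (0 : ℝ)) j * (L : ℝ) ^ d ≤ 1 / 2 := fun _ => by norm_num
  have hUst1 : ∀ b' : Bond d (towerP L m (n + 1)), star ((fun _ : Bond d (towerP L m (n + 1)) => (1 : 𝔸ˣ)) b' : 𝔸) = ((((fun _ : Bond d (towerP L m (n + 1)) => (1 : 𝔸ˣ)) b')⁻¹ : 𝔸ˣ) : 𝔸) := fun _ => by simp
  have hposπ₁ := (laplaceAkPi_one_pos_iff L m n φ τ η a' hpos'₁ hL (fun _ => 0) (fun _ => by norm_num)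
    (perCfg_UlevOf_one_mem_U1 L m (n + 1)) (norm_Wcx_UlevOf_one_sub_one_le L m (n + 1) (fun _ => 0) (fun _ => le_rfl)) a (c₀ := c₀)).mpr hpos₁
  have hQ1 := QkW_surjective L m n φ (fun _ : Bond d (towerP L m (n + 1)) => (1 : 𝔸ˣ)) hL (fun _ => 0) (fun _ => by norm_num)
    (perCfg_UlevOf_one_mem_U1 L m (n + 1)) (norm_Wcx_UlevOf_one_sub_one_le L m (n + 1) (fun _ => 0) (fun _ => le_rfl)) (c₀ := c₀) (c₁ := c₁) hαL1
  set piS : TSite d (towerP L m (n + 1)) → TSite d m := fun x => blockCoord (L ^ (n + 1)) m (siteCast (towerP_eq_fineP_pow L m (n + 1)) x) with hpiS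
  set Gt := G1LatticeK hposπ with hGt
  set G1 := G1k L m n φ η (fun _ : Bond d (towerP L m (n + 1)) => (1 : 𝔸ˣ)) hL (fun _ => 0) (fun _ => by norm_num)
                (perCfg_UlevOf_one_mem_U1 L m (n + 1)) (norm_Wcx_UlevOf_one_sub_one_le L m (n + 1) (fun _ => 0) (fun _ => le_rfl)) τ (c₀ := c₀) (c₁ := c₁) hpos₁ with hG1
  set RU := RofUk L m n φ η U (c₀ := c₀) with hRU
  set R1 := RofUk L m n φ η (fun _ : Bond d (towerP L m (n + 1)) => (1 : 𝔸ˣ)) (c₀ := c₀) with hR1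
  set DsU := covDivL2K ℂ c₀ ((η : ℂ))⁻¹ (adTransportW φ fun bb => (U bb)⁻¹) with hDsU
  set Ds1 := covDivL2K ℂ c₀ ((η : ℂ))⁻¹ (adTransportW φ fun bb => ((fun _ : Bond d (towerP L m (n + 1)) => (1 : 𝔸ˣ)) bb)⁻¹) with hDs1
  set DU := covDerivL2K ℂ c₀ ((η : ℂ))⁻¹ (adTransportW φ U) with hDU
  set D1 := covDerivL2K ℂ c₀ ((η : ℂ))⁻¹ (adTransportW φ (fun _ : Bond d (towerP L m (n + 1)) => (1 : 𝔸ˣ))) with hD1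
  obtain ⟨ωU, hωU⟩ : ∃ w : SiteL2K ℂ d (towerP L m (n + 1)) c₀ W, w = RU ((GpOfUk L m n φ η U a' (c₁ := c₁) hpos') (DsU f)) := ⟨_, rfl⟩
  obtain ⟨uU, huU⟩ : ∃ u : SiteL2K ℂ d (towerP L m (n + 1)) c₀ W, u = (GpOfUk L m n φ η U a' (c₁ := c₁) hpos') ωU := ⟨_, rfl⟩
  obtain ⟨ω1, hω1⟩ : ∃ w : SiteL2K ℂ d (towerP L m (n + 1)) c₀ W, w = R1 ((GpOfUk L m n φ η (fun _ : Bond d (towerP L m (n + 1)) => (1 : 𝔸ˣ)) a' (c₁ := c₁) hpos'₁) (Ds1 f)) := ⟨_, rfl⟩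
  obtain ⟨u1, hu1⟩ : ∃ u : SiteL2K ℂ d (towerP L m (n + 1)) c₀ W, u = (GpOfUk L m n φ η (fun _ : Bond d (towerP L m (n + 1)) => (1 : 𝔸ˣ)) a' (c₁ := c₁) hpos'₁) ω1 := ⟨_, rfl⟩
  have hEqU : covLaplaceSiteK (c₀ := c₀) ((η : ℂ))⁻¹ (adTransportW φ U) (adTransportW φ fun bb => (U bb)⁻¹) uU = ωU := by
    rw [huU, hωU, hRU]; exact covLaplaceSiteK_GpOfUk_RofUk L m n φ η U a' hpos' _
  have hEq1 : covLaplaceSiteK (c₀ := c₀) ((η : ℂ))⁻¹ (adTransportW φ (fun _ : Bond d (towerP L m (n + 1)) => (1 : 𝔸ˣ)))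
      (adTransportW φ fun bb => ((fun _ : Bond d (towerP L m (n + 1)) => (1 : 𝔸ˣ)) bb)⁻¹) u1 = ω1 := by
    rw [hu1, hω1, hR1]; exact covLaplaceSiteK_GpOfUk_RofUk L m n φ η (fun _ : Bond d (towerP L m (n + 1)) => (1 : 𝔸ˣ)) a' hpos'₁ _
  have e1 : Gt (DU (RU (DsU (Gt f)))) = DU uU := by
    rw [huU, hωU]; exact thirdWord_G1LatticeKPi_eq L m n φ τ hτ₁ hτ₂ hφτ η U hUst a' hpos' hL αU hα1 hU1 hreg a hposπ f
  have e2 := thirdWord_G1LatticeKPi_eq L m n φ τ hτ₁ hτ₂ hφτ η (fun _ : Bond d (towerP L m (n + 1)) => (1 : 𝔸ˣ)) hUst1 a' hpos'₁ hL (fun _ => 0) (fun _ => by norm_num)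
    (perCfg_UlevOf_one_mem_U1 L m (n + 1)) (norm_Wcx_UlevOf_one_sub_one_le L m (n + 1) (fun _ => 0) (fun _ => le_rfl)) a hposπ₁ f
  have e3 : G1LatticeK hposπ₁ = G1 := (letters_laplaceAkPi_one L m n φ τ η a' hpos'₁ hL (fun _ => 0) (fun _ => by norm_num)
      (perCfg_UlevOf_one_mem_U1 L m (n + 1)) (norm_Wcx_UlevOf_one_sub_one_le L m (n + 1) (fun _ => 0) (fun _ => le_rfl)) a hposπ₁ hpos₁ hQ1).1
  rw [e3] at e2
  have e2' : G1 (D1 (R1 (Ds1 (G1 f)))) = D1 u1 := by rw [hu1, hω1]; exact e2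
  rw [e1, e2']
  -- the word is `D_Uu` at both backgrounds ((3.152)); its flat gradient is the flat covariant derivative of the slice difference
  have hslice : covGrad ((η : ℂ))⁻¹ (adTransportW φ (fun _ : Bond d (towerP L m (n + 1)) => (1 : 𝔸ˣ)))
        (WL2.equiv ℂ (fun _ : Bond d (towerP L m (n + 1)) => c₀) W (DU uU - D1 u1)) (bd, μ) =
      WL2.equiv ℂ (fun _ : Bond d (towerP L m (n + 1)) => c₀) W (D1
        (((WL2.equiv ℂ (fun _ : TSite d (towerP L m (n + 1)) => c₀) W).symm fun y =>
            WL2.equiv ℂ (fun _ : Bond d (towerP L m (n + 1)) => c₀) W (DU uU) (y, μ)) -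
          ((WL2.equiv ℂ (fun _ : TSite d (towerP L m (n + 1)) => c₀) W).symm fun y =>
            WL2.equiv ℂ (fun _ : Bond d (towerP L m (n + 1)) => c₀) W (D1 u1) (y, μ)))) bd := by
    rw [covGrad_eq_covDeriv_comp, hD1, equiv_covDerivL2K]
    congr 1
  rw [hslice]
  obtain ⟨ha0s, ha1s, hlams, haKs⟩ := rate_explicit (d := d) η⁻¹ 1 one_pos (by rw [hηK]; exact hK1)
  have hasq : Real.sqrt (1 / (4 * d * η⁻¹ ^ 2 + 1)) ^ 2 = 1 / (4 * d * η⁻¹ ^ 2 + 1) := Real.sq_sqrt (by positivity)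
  obtain ⟨ar, har0, _, hat, hlam, haκ', hδ'⟩ := rate_letters (κ := κs) hd1 (inv_pos.2 hη0) ha0s ha1s hκs0 hlams hasq haKs
  have haκH : ar * d * (L : ℝ) ^ (n + 1) ≤ κH := by rw [← hηK]; exact haκ'.trans (min_le_left _ _)
  have haκB : ar * d * (L : ℝ) ^ (n + 1) ≤ κB := by rw [← hηK]; exact haκ'.trans (min_le_right _ _)
  have haK1 : ar * (L : ℝ) ^ (n + 1) ≤ 1 := by rw [← hηK]; exact hat
  have hlamK : 2 * (d : ℝ) * ((L : ℝ) ^ (n + 1)) ^ 2 * (Real.cosh ar - 1) ≤ 1 / 2 := by rw [← hηK]; linarith only [hlam]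
  have hδK : δ₃ ≤ ar * (L : ℝ) ^ (n + 1) := (min_le_right _ _).trans (by rw [← hηK]; exact hδ')
  have hexp1 : Real.exp (ar * ((L : ℝ) ^ (n + 1) - 1)) ≤ 3 :=
    (Real.exp_le_exp.2 (by nlinarith only [har0, haK1] : ar * ((L : ℝ) ^ (n + 1) - 1) ≤ 1)).trans (by have := Real.exp_one_lt_d9; linarith only [this])
  -- (4) the conversion of block decay (any rate `≥ δ₃`) to the weight centred at `b₋`
  set x₀ : TSite d (towerP L m (n + 1)) := bpos bd with hx₀
  set D₀ : ℝ := tdist m (piS x₀) v with hD₀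
  set Wt : TSite d (towerP L m (n + 1)) → ℝ := fun y => ∏ ν, Real.cosh (ar * (circAbs (towerP L m (n + 1) ν)
    ((((x₀ ν : ℕ) : ZMod (towerP L m (n + 1) ν)) - ((y ν : ℕ) : ZMod (towerP L m (n + 1) ν))).val) : ℝ)) with hWt
  have hW0 : ∀ y, 0 ≤ Wt y := fun y => (weight_site_pos (towerP L m (n + 1)) ar x₀ y).le
  have hconv : ∀ {δ : ℝ} (y : TSite d (towerP L m (n + 1))), δ₃ ≤ δ → Real.exp (-(δ * tdist m (piS y) v)) ≤ 6 * Real.exp (-(δ₃ * D₀)) * Wt y := by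
    intro δ y hδ
    set Dy : ℝ := tdist m (piS y) v with hDy
    set Dxy : ℝ := tdist m (piS x₀) (piS y) with hDxy
    obtain ⟨htri, hDy0, hDxy0⟩ : D₀ ≤ Dxy + Dy ∧ 0 ≤ Dy ∧ 0 ≤ Dxy := ⟨tdist_triangle hm _ _ _, tdist_nonneg m _ _, tdist_nonneg m _ _⟩
    have hW := exp_bigBlockDist_le_weight_site L m n har0 x₀ y
    have h1 : -(δ * Dy) ≤ -(δ₃ * D₀) + ar * (L : ℝ) ^ (n + 1) * Dxy := by
      nlinarith [mul_le_mul_of_nonneg_right hδ hDy0, mul_le_mul_of_nonneg_left htri hδ₃0.le, mul_le_mul_of_nonneg_right hδK hDxy0]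
    calc Real.exp (-(δ * Dy)) ≤ Real.exp (-(δ₃ * D₀) + ar * (L : ℝ) ^ (n + 1) * Dxy) := Real.exp_le_exp.2 h1
      _ = Real.exp (-(δ₃ * D₀)) * Real.exp (ar * (L : ℝ) ^ (n + 1) * Dxy) := Real.exp_add _ _
      _ ≤ Real.exp (-(δ₃ * D₀)) * (Real.exp (ar * ((L : ℝ) ^ (n + 1) - 1)) * 2 * Wt y) := mul_le_mul_of_nonneg_left hW (Real.exp_pos _).le
      _ ≤ Real.exp (-(δ₃ * D₀)) * (3 * 2 * Wt y) :=
          mul_le_mul_of_nonneg_left (mul_le_mul_of_nonneg_right (mul_le_mul_of_nonneg_right hexp1 (by norm_num)) (hW0 y)) (Real.exp_pos _).le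
      _ = 6 * Real.exp (-(δ₃ * D₀)) * Wt y := by ring
  set E : ℝ := 6 * Real.exp (-(δ₃ * D₀)) with hE
  -- (5) the ONE-background rows of `ω(U)`, `u(U)` ((HR) at the radius `α′`) in the weighted currency
  obtain ⟨hωN, hωH, huN, hwN⟩ := HA n η hηL c₀ c₁ hw hρ m hm U αU hα0 hα1 hU1 hreg εU hεU hUε hLb α' hα'0 hα'a hUst hUb hUη' hpl' hUgrad' hRlev hεg' hAQ hpos' hpos
    hposπ hc₀η hJ' v f F hfv hfF
  set N : ℝ := Ba * E * F with hN
  have hN0 : 0 ≤ N := by positivity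
  have hrow : ∀ y : TSite d (towerP L m (n + 1)), Ba * Real.exp (-(δa * tdist m (piS y) v)) * F ≤ N * Wt y := fun y =>
    (mul_le_mul_of_nonneg_right (mul_le_mul_of_nonneg_left (hconv y hδ₃a) hBa) hF).trans (le_of_eq (by rw [hN]; ring))
  have hωN' : ∀ y, ‖WL2.equiv ℂ (fun _ : TSite d (towerP L m (n + 1)) => c₀) W ωU y‖ ≤ N * Wt y := fun y => by rw [hωU, hRU, hDsU]; exact (hωN y).trans (hrow y)
  have hωH' : ∀ y y' : TSite d (towerP L m (n + 1)), tdist (towerP L m (n + 1)) y y' ≤ (L : ℝ) ^ (n + 1) →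
      ‖WL2.equiv ℂ (fun _ : TSite d (towerP L m (n + 1)) => c₀) W ωU y' - WL2.equiv ℂ (fun _ : TSite d (towerP L m (n + 1)) => c₀) W ωU y‖ ≤
        N * Wt y * (tdist (towerP L m (n + 1)) y y' / (L : ℝ) ^ (n + 1)) ^ ((1 : ℝ) / 2) := fun y y' hyy => by
    rw [hωU, hRU, hDsU]
    refine (hωH y y' hyy).trans (le_trans (le_of_eq (by ring)) (mul_le_mul_of_nonneg_right (hrow y) (Real.rpow_nonneg (div_nonneg (tdist_nonneg _ y y') hK0.le) _)))
  have huN' : ∀ y, ‖WL2.equiv ℂ (fun _ : TSite d (towerP L m (n + 1)) => c₀) W uU y‖ ≤ N * Wt y := fun y => by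
    rw [huU, hωU, hRU, hDsU]; exact (huN y).trans (hrow y)
  have hwN' : ∀ bb, ‖WL2.equiv ℂ (fun _ : Bond d (towerP L m (n + 1)) => c₀) W (DU uU) bb‖ ≤ N * Wt (bpos bb) := fun bb => by
    rw [huU, hωU, hRU, hDsU, hDU]; exact (hwN bb).trans (hrow (bpos bb))
  -- (6) the one-background covariant Hessian slice row (gen 95, CLOSED) at the radius `α′`
  have hhN' : ∀ bb, ‖WL2.equiv ℂ (fun _ : Bond d (towerP L m (n + 1)) => c₀) W (covDerivL2K ℂ c₀ ((η : ℂ))⁻¹ (adTransportW φ U)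
      ((WL2.equiv ℂ (fun _ : TSite d (towerP L m (n + 1)) => c₀) W).symm fun y =>
        WL2.equiv ℂ (fun _ : Bond d (towerP L m (n + 1)) => c₀) W (covDerivL2K ℂ c₀ ((η : ℂ))⁻¹ (adTransportW φ U) uU) (y, μ))) bb‖ ≤
      ΘH * (N + N + N + N) * Wt (bpos bb) := fun bb =>
    HH n η hηL c₀ c₁ hw m U α' hα'0 hα'H hUb hUη' hUgrad' hplU' hJ' εU hεU hεg' hUε hLb hUst hRlev hpos' hpos₁U ar har0 haκH haK1 hlamK x₀ uU ωU N N N N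
      hN0 hN0 hN0 hN0 hEqU hωN' hωH' huN' (by rw [← hDU]; exact hwN') μ bb
  -- (7) the TWO-background rows: `ω(U) − ω(1)` (value: gen 102's letter; η-Hölder: `Hω`), and the slice difference (gen 102's letter of the third word)
  set N' : ℝ := (j₀ + α) * KO * E * F with hN'
  set H' : ℝ := (j₀ + α) * Kω * E * F with hH'
  set M' : ℝ := (j₀ + α) * KT * E * F with hM'
  obtain ⟨hN'0, hH'0, hM'0⟩ : 0 ≤ N' ∧ 0 ≤ H' ∧ 0 ≤ M' := ⟨by positivity, by positivity, by positivity⟩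
  have hδN' : ∀ y, ‖WL2.equiv ℂ (fun _ : TSite d (towerP L m (n + 1)) => c₀) W ωU y - WL2.equiv ℂ (fun _ : TSite d (towerP L m (n + 1)) => c₀) W ω1 y‖ ≤ N' * Wt y := by
    intro y
    rw [← Pi.sub_apply, ← WL2.equiv_sub, hωU, hω1, hRU, hR1, hDsU, hDs1]
    refine (HO n η hηL c₀ c₁ hw hρ m hm U αU hα0 hα1 hαL hU1 hreg εU hεU hε1 hUε hLb α hα hαO' hUst hUb hUη hUw hpl hUgrad hRlev hεg hAQ hpos' hpos hc₀η j₀ hJ hjO'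
      hposπ hQ hpos'₁ hpos₁ v f F hfv hfF y).trans ((mul_le_mul_of_nonneg_right (mul_le_mul_of_nonneg_left (hconv y hδ₃O) (mul_nonneg (add_nonneg hj₀ hα) hKO)) hF).trans ?_)
    rw [hN']; exact le_of_eq (by ring)
  have hδH' : ∀ y y' : TSite d (towerP L m (n + 1)), tdist (towerP L m (n + 1)) y y' ≤ (L : ℝ) ^ (n + 1) →
      ‖(WL2.equiv ℂ (fun _ : TSite d (towerP L m (n + 1)) => c₀) W ωU y' - WL2.equiv ℂ (fun _ : TSite d (towerP L m (n + 1)) => c₀) W ω1 y') -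
          (WL2.equiv ℂ (fun _ : TSite d (towerP L m (n + 1)) => c₀) W ωU y - WL2.equiv ℂ (fun _ : TSite d (towerP L m (n + 1)) => c₀) W ω1 y)‖ ≤
        H' * Wt y * (tdist (towerP L m (n + 1)) y y' / (L : ℝ) ^ (n + 1)) ^ ((1 : ℝ) / 2) := by
    intro y y' hyy
    rw [← Pi.sub_apply, ← Pi.sub_apply _ _ y, ← WL2.equiv_sub, hωU, hω1, hRU, hR1, hDsU, hDs1]
    refine (HΩ n η hηL c₀ c₁ hw hρ m hm U αU hα0 hα1 hαL hU1 hreg εU hεU hε1 hUε hLb α hα hαω' hUst hUb hUη hUw hpl hUgrad hRlev hεg hAQ hpos' hpos hc₀η j₀ hJ hjω'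
      hposπ hQ hpos'₁ hpos₁ v f F hfv hfF y y' hyy).trans ?_
    have hs0 : 0 ≤ (tdist (towerP L m (n + 1)) y y' / (L : ℝ) ^ (n + 1)) ^ ((1 : ℝ) / 2) := Real.rpow_nonneg (div_nonneg (tdist_nonneg _ y y') hK0.le) _
    calc _ ≤ (j₀ + α) * Kω * (E * Wt y) * (tdist (towerP L m (n + 1)) y y' / (L : ℝ) ^ (n + 1)) ^ ((1 : ℝ) / 2) * F :=
          mul_le_mul_of_nonneg_right (mul_le_mul_of_nonneg_right (mul_le_mul_of_nonneg_left (hconv y hδ₃ω) (mul_nonneg (add_nonneg hj₀ hα) hKω)) hs0) hF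
      _ = H' * Wt y * (tdist (towerP L m (n + 1)) y y' / (L : ℝ) ^ (n + 1)) ^ ((1 : ℝ) / 2) := by rw [hH']; ring
  have hδw' : ∀ y : TSite d (towerP L m (n + 1)), ‖WL2.equiv ℂ (fun _ : Bond d (towerP L m (n + 1)) => c₀) W (DU uU) (y, μ) -
      WL2.equiv ℂ (fun _ : Bond d (towerP L m (n + 1)) => c₀) W (D1 u1) (y, μ)‖ ≤ M' * Wt y := by
    intro y
    have hT := HT n η hηL c₀ c₁ hw hρ m hm U αU hα0 hα1 hαL hU1 hreg εU hεU hε1 hUε hLb α hα hαT' hUst hUb hUη hUw hpl hUgrad hRlev hεg hAQ hpos' hpos hc₀η j₀ hJ hjT'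
      hposπ hQ hpos'₁ hpos₁ v f F hfv hfF (y, μ)
    rw [e1, e2', WL2.equiv_sub, Pi.sub_apply] at hT
    refine hT.trans ((mul_le_mul_of_nonneg_right (mul_le_mul_of_nonneg_left (hconv y hδ₃T) (mul_nonneg (add_nonneg hj₀ hα) hKT)) hF).trans (le_of_eq ?_))
    rw [hM']; ring
  -- (8) THE TWO-BACKGROUND HESSIAN SLICE ROW (this generation's `B9Eq344CovariantHessianTwoBackgroundRowTower`) at the centre `b₋`
  have hmain := HB n η hηL c₀ c₁ hw m U α hα hαB' hUb hUη hUw hplU j₀ hj₀ hJ hUst hpos'₁ ar har0 haκB haK1 hlamK x₀ uU ωU u1 ω1 N N N N (ΘH * (N + N + N + N)) N' H' M'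
    hN0 hN0 hN0 hN0 (by positivity) hN'0 hH'0 hM'0 hEqU hEq1 hωN' hωH' huN' (by rw [← hDU]; exact hwN') μ hhN' hδN' hδH' (by rw [← hDU, ← hD1]; exact hδw') bd
  rw [← hDU, ← hD1, hx₀, weight_site_centre (towerP L m (n + 1)) ar (bpos bd), mul_one] at hmain
  refine hmain.trans ?_
  -- (9) the constants and the re-blocking `Π(b₋) ↦ Π(b₊)`
  set DT : ℝ := tdist m (piS (btgt bd)) v with hDT
  have hreblock : Real.exp (-(δ₃ * D₀)) ≤ Real.exp δ₃ * Real.exp (-(δ₃ * DT)) := by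
    rw [← Real.exp_add]
    have h2 := tdist_bigBlock_bpos_btgt_le_one L m (n + 1) hm bd
    rw [tdist_symm hm] at h2
    have htri : DT ≤ D₀ + 1 := by have h1 := tdist_triangle hm (piS (btgt bd)) (piS (bpos bd)) v; rw [hD₀, hx₀]; linarith
    exact Real.exp_le_exp.mpr (by nlinarith [mul_le_mul_of_nonneg_left htri hδ₃0.le])
  have hX : ΘB * ((α + j₀) * (N + N + N + N + ΘH * (N + N + N + N)) + (N' + H' + M')) =
      (j₀ + α) * (ΘB * 6 * (4 * Ba * (1 + ΘH) + (KO + Kω + KT))) * Real.exp (-(δ₃ * D₀)) * F := by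
    rw [hN, hN', hH', hM', hE]; ring
  rw [hX]
  have hC0 : 0 ≤ (j₀ + α) * (ΘB * 6 * (4 * Ba * (1 + ΘH) + (KO + Kω + KT))) := by positivity
  calc (j₀ + α) * (ΘB * 6 * (4 * Ba * (1 + ΘH) + (KO + Kω + KT))) * Real.exp (-(δ₃ * D₀)) * F
      ≤ (j₀ + α) * (ΘB * 6 * (4 * Ba * (1 + ΘH) + (KO + Kω + KT))) * (Real.exp δ₃ * Real.exp (-(δ₃ * DT))) * F :=
        mul_le_mul_of_nonneg_right (mul_le_mul_of_nonneg_left hreblock hC0) hF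
    _ = (j₀ + α) * Kfin * Real.exp (-(δ₃ * DT)) * F := by rw [hKfin]; ring

end Literature.MathematicalPhysics.QuantumFieldTheory.Balaban1983to89.B9Eq3152ThirdWordPiTwoBackgroundGradLetterOfOmegaHolder

end
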